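import Summits.AtomisticToContinuum.Crystallization.Theorems.PricedLinkCensusChargedPeriodicIsOptimal
import Summits.AtomisticToContinuum.Crystallization.Theorems.CoarseGrains.Negative.PredicateAPI

/-!
# Line `Sketch` (crux `FineGrains`, stmt-AtomisticToContinuum-9330): self-certifying grains

Stub `stub_selfCertify` of the line skeleton `Sketch` (card `self-certifying-grains`): a periodic
configuration `P` of `ℝ³` which appears, for every radius `R` and tolerance `ε` (and frequently
in the particle number `N`), as an origin-based isometric two-way `ε`-fine `R`-chart at a
particle `x i` of a Lennard-Jones ground state `x`, is a MINIMISER of the energy per particle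
over all periodic configurations.

Proof (excision of one matched block; everything needed is already in the tree).  Since
`e* = ⨅_Q e(Q) ≤ e(Q)` for every periodic `Q` (`eStar_le`, item 0714), it suffices to show
`e(P) ≤ e*`, i.e. `e(P) ≤ e* + η` for every `η > 0`.  Fix `η`.

* Thermodynamic limit at a FIXED small size: `E(M)/M → e*` (`crysEnergyLimit`, item 0626), so
  `E(M) ≤ M (e* + η/8)` for `M ≥ n₀`.
* Block of `P`: for `K ≥ K₀` the block `F + [0,K)³·b` of `n = #F·K³ ≥ n₀` points has
  `2·E(block) ≥ 2n·e(P) − (δ_P⁻⁶/12)·Σ_u tailSix u` with `Σ_u tailSix u ≤ t·2n` small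
  (`two_mul_energy_block_ge`, `exists_sum_tailSix_le`).
* Re-basing the chart (`exists_based_chart`): the converse matching applied to the centre
  `x i` itself produces a point `q ∈ P` with `‖q‖ ≤ ε/2`, and the origin-based chart of radius
  `R + ε/2` and tolerance `ε/2` is a `q`-based chart of radius `R` and tolerance `ε` in the sense
  of item 2913 (`ChargedPeriodicIsOptimal`).
* Excision of the single patch matched to the block (`surgery_estimate` with one good particle,
  `patch_budget`): `E(N − n) + n·(e(P) − 3η/8) ≤ E(N)`, where the hypothesis is invoked with
  `N₀ = n + 1` so that `0 < n < N`.
* Strict binding (`groundStateEnergy_add_lt`, Blanc–Lewin 2015 (6), with the ground states of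
  `LennardJonesGroundStatesExist_holds`): `E(N) < E(n) + E(N − n)`.

Hence `n·(e(P) − 3η/8) < E(n) ≤ n·(e* + η/8)`, i.e. `e(P) < e* + η/2`.  Note that the
"frequently in `N`" clause is used only to make `N > n`; no rate in the thermodynamic limit is
needed because the comparison `E(N) − E(N − n) < E(n)` is made at the fixed size `n`.
All `[folklore]`.
-/

noncomputable section

namespace Summit.AtomisticToContinuum.Crystallization.Theorems.ExcessDecayLiouvilleFineGrains

open Literature.MathematicalPhysics.StatisticalMechanics
open Summit.AtomisticToContinuum.Crystallization.Theorems.CoarseGrains.Negative.PredicateAPI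
open Summit.AtomisticToContinuum.Crystallization.Theorems.ChargedEnergyGapNegative
  (eStar eStar_le crysEnergyLimit)
open Summit.AtomisticToContinuum.Crystallization.Theorems.ChargedEnergyGapNegative.Blocks
open Summit.AtomisticToContinuum.Crystallization.Theorems.ChargedPeriodicOptimal
open scoped BigOperators
open Filter Topology Metric

/-- **Re-basing an origin-based chart at a point of `P`.**  If the sites `x i + A p`
(`p ∈ P`, `‖p‖ ≤ R + ε/2`) are `ε/2`-occupied and the particles within `R + ε/2` of `x i` are
`ε/2`-close to sites, then the particle `x i` itself is `ε/2`-close to a site `x i + A q`,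
`q ∈ P`, `‖q‖ ≤ ε/2`, and relative to the base point `q` the chart is a two-way `ε`-matching of
radius `R` in the form of item 2913: sites `x i + A (s − q)`, `s ∈ P`, `dist s q ≤ R`.
[folklore] -/
theorem exists_based_chart {P : PeriodicConfiguration 3} {N : ℕ} {x : Fin N → E3} {i : Fin N}
    {A : E3 →ₗᵢ[ℝ] E3} {R ε : ℝ} (hR : 0 ≤ R) (hε : 0 ≤ ε)
    (h1 : ∀ p ∈ P.points, ‖p‖ ≤ R + ε / 2 → ∃ j : Fin N, dist (x j) (x i + A p) ≤ ε / 2)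
    (h2 : ∀ j : Fin N, dist (x j) (x i) ≤ R + ε / 2 →
      ∃ p ∈ P.points, dist (x j) (x i + A p) ≤ ε / 2) :
    ∃ q ∈ P.points,
      (∀ s ∈ P.points, dist s q ≤ R → ∃ j : Fin N, dist (x j) (x i + A (s - q)) ≤ ε) ∧
      (∀ j : Fin N, dist (x j) (x i) ≤ R →
        ∃ s ∈ P.points, dist (x j) (x i + A (s - q)) ≤ ε) := by
  obtain ⟨q, hq, hq0⟩ := h2 i (by rw [dist_self]; positivity)
  have hqn : ‖q‖ ≤ ε / 2 := by rwa [dist_self_add_right, A.norm_map] at hq0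
  have hshift : ∀ s : E3, dist (x i + A s) (x i + A (s - q)) = ‖q‖ := fun s => by
    rw [dist_add_left, A.dist_map, dist_eq_norm, sub_sub_cancel]
  refine ⟨q, hq, fun s hs hsq => ?_, fun j hj => ?_⟩
  · have hsn : ‖s‖ ≤ R + ε / 2 := by
      have h := norm_le_norm_add_norm_sub' s q
      rw [← dist_eq_norm] at h
      linarith
    obtain ⟨j, hj⟩ := h1 s hs hsn
    refine ⟨j, ?_⟩
    have h := dist_triangle (x j) (x i + A s) (x i + A (s - q))
    rw [hshift] at h
    linarith
  · obtain ⟨s, hs, hsj⟩ := h2 j (by linarith)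
    refine ⟨s, hs, ?_⟩
    have h := dist_triangle (x j) (x i + A s) (x i + A (s - q))
    rw [hshift] at h
    linarith

/-- **The self-certifying estimate `e(P) ≤ e*`.**  If a periodic configuration `P` of `ℝ³`
appears, for every `R, ε > 0` and frequently in `N`, as an origin-based isometric two-way
`ε`-fine `R`-chart at a particle of a Lennard-Jones ground state of `N` particles, then
`e(P) ≤ e* = ⨅_Q e(Q)` (excision of one matched block + strict binding + the thermodynamic
limit at the fixed block size; see the module docstring). [folklore] -/
theorem energyPerParticle_le_eStar_of_charts (P : PeriodicConfiguration 3)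
    (H : ∀ R ε : ℝ, 0 < R → 0 < ε → ∀ N₀ : ℕ, ∃ N : ℕ, N₀ ≤ N ∧ ∃ x : Fin N → E3,
      IsGroundState lennardJones x ∧ ∃ (i : Fin N) (A : E3 →ₗᵢ[ℝ] E3),
        (∀ p ∈ P.points, ‖p‖ ≤ R → ∃ j : Fin N, dist (x j) (x i + A p) ≤ ε) ∧
        (∀ j : Fin N, dist (x j) (x i) ≤ R → ∃ p ∈ P.points, dist (x j) (x i + A p) ≤ ε)) :
    P.energyPerParticle lennardJones ≤ eStar := by
  classical
  -- constants of the problem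
  obtain ⟨δL, hδL, hsepL⟩ := LennardJonesMinimalDistance_holds
  obtain ⟨δQ, hδQ, hsepQ⟩ := P.exists_pos_le_dist
  have hFpos : 0 < P.motif.card := P.motif_nonempty.card_pos
  have hF : (0 : ℝ) < P.motif.card := by exact_mod_cast hFpos
  refine le_of_forall_pos_le_add fun η hη => ?_
  -- STEP 0: the thermodynamic threshold `n₀` at tolerance `η/8`
  have hlim : Tendsto (fun M : ℕ => groundStateEnergy lennardJones 3 M / M) atTop (𝓝 eStar) :=
    crysEnergyLimit
  obtain ⟨n₀, hn₀⟩ := Metric.tendsto_atTop.1 hlim (η / 8) (by positivity)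
  -- STEP 1: the block size `K` (small sixth-power tails and `#block ≥ n₀`)
  have hcQ0 : (0 : ℝ) < 1 / 12 * δQ⁻¹ ^ 6 + 64 / 3 := by positivity
  have htpos : 0 < η / 8 / (1 / 12 * δQ⁻¹ ^ 6 + 64 / 3) := by positivity
  obtain ⟨K₀, hK₀0, hK₀⟩ := exists_sum_tailSix_le P htpos
  obtain ⟨K, hKK₀, hKn₀⟩ : ∃ K : ℕ, K₀ ≤ K ∧ n₀ ≤ K := ⟨max K₀ n₀, le_max_left _ _, le_max_right _ _⟩
  have hK0 : 0 < K := hK₀0.trans_le hKK₀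
  have hncard : ((Fintype.card (BIdx P K) : ℕ) : ℝ) = P.motif.card * (K : ℝ) ^ 3 := by
    rw [card_BIdx]; push_cast; ring
  have hnpos : 0 < Fintype.card (BIdx P K) := by
    rw [card_BIdx]; exact Nat.mul_pos hFpos (pow_pos hK0 3)
  have hnr : (0 : ℝ) < Fintype.card (BIdx P K) := by exact_mod_cast hnpos
  have hn₀n : n₀ ≤ Fintype.card (BIdx P K) := by
    rw [card_BIdx]
    calc n₀ ≤ K := hKn₀
      _ ≤ K ^ 3 := Nat.le_self_pow (by norm_num) K
      _ ≤ P.motif.card * K ^ 3 := Nat.le_mul_of_pos_left _ hFpos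
  have htails : ∑ u : BIdx P K, tailSix P K u ≤
      η / 8 / (1 / 12 * δQ⁻¹ ^ 6 + 64 / 3) * (2 * Fintype.card (BIdx P K)) := by
    have h := hK₀ K hKK₀
    rw [hncard]
    linarith
  have hblock := two_mul_energy_block_ge P K hδQ hsepQ
  have hK3 : (K : ℝ) ^ 3 * (2 * P.motif.card * P.energyPerParticle lennardJones) =
      2 * Fintype.card (BIdx P K) * P.energyPerParticle lennardJones := by
    rw [hncard]; ring
  rw [hK3] at hblock
  -- STEP 2: block radius, energy modulus, tolerance `ε`, margin `T`
  obtain ⟨R₀, hR₀0, hR₀⟩ := exists_block_radius P K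
  obtain ⟨ε₀, hε₀, hmod⟩ := exists_energy_modulus_block P K
    (show 0 < η / 8 * Fintype.card (BIdx P K) by positivity)
  obtain ⟨ε, hεpos, hεε₀, hεQ, hεL⟩ : ∃ ε : ℝ, 0 < ε ∧ ε ≤ ε₀ ∧ 4 * ε ≤ δQ ∧ 2 * ε < δL := by
    refine ⟨min ε₀ (min (δQ / 4) (δL / 4)), lt_min hε₀ (lt_min (by positivity) (by positivity)),
      min_le_left _ _, ?_, ?_⟩
    · have : min ε₀ (min (δQ / 4) (δL / 4)) ≤ δQ / 4 := (min_le_right _ _).trans (min_le_left _ _)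
      linarith
    · have : min ε₀ (min (δQ / 4) (δL / 4)) ≤ δL / 4 :=
        (min_le_right _ _).trans (min_le_right _ _)
      linarith
  obtain ⟨T, hTpos, hfarT⟩ : ∃ T : ℝ, 0 < T ∧ 1 / 6 * (250 * δL⁻¹ ^ 5 * T⁻¹) ≤ η / 8 := by
    refine ⟨2000 * δL⁻¹ ^ 5 / η + 1, by positivity, ?_⟩
    have h2 : 0 < 2000 * δL⁻¹ ^ 5 / η := by positivity
    have h3 : (2000 * δL⁻¹ ^ 5 / η + 1)⁻¹ ≤ (2000 * δL⁻¹ ^ 5 / η)⁻¹ := inv_anti₀ h2 (by linarith)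
    rw [inv_div] at h3
    have h4 : 0 ≤ δL⁻¹ ^ 5 := by positivity
    calc 1 / 6 * (250 * δL⁻¹ ^ 5 * (2000 * δL⁻¹ ^ 5 / η + 1)⁻¹)
        ≤ 1 / 6 * (250 * δL⁻¹ ^ 5 * (η / (2000 * δL⁻¹ ^ 5))) := by gcongr
      _ = η / 48 := by field_simp; ring
      _ ≤ η / 8 := by linarith
  have hRpos : 0 < R₀ + ε + T := by positivity
  -- STEP 3: a ground state of `N > n` particles with an origin-based chart of radius
  -- `R + ε/2` and tolerance `ε/2`, re-based at a point `q ∈ P`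
  obtain ⟨N, hNn, x, hx, i, A, hC1, hC2⟩ :=
    H (R₀ + ε + T + ε / 2) (ε / 2) (by positivity) (by positivity) (Fintype.card (BIdx P K) + 1)
  have hsepx : ∀ k l, k ≠ l → δL ≤ dist (x k) (x l) := hsepL N x hx
  obtain ⟨q, hq, hA, hB⟩ := exists_based_chart hRpos.le hεpos.le hC1 hC2
  -- STEP 4: the excision estimate with the single patch at `i`
  obtain ⟨-, hsurg⟩ := surgery_estimate P K hx.1 hδL hsepx hδQ hsepQ hR₀ hmod hεpos hεε₀
    hεQ hεL hTpos le_rfl {i}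
    (fun t ht => by
      rcases Finset.mem_singleton.1 ht with rfl
      exact ⟨A, q, hq, hA, hB⟩)
    (fun t ht t' ht' hne => absurd
      ((Finset.mem_singleton.1 ht).trans (Finset.mem_singleton.1 ht').symm) hne)
  have hbudget := patch_budget (Nat.cast_nonneg _) hnr.le
    (by positivity : (0 : ℝ) ≤ 1 / 12 * δQ⁻¹ ^ 6) hblock htails hsurg hfarT (by field_simp)
  simp only [Finset.card_singleton, Nat.cast_one, one_mul] at hbudget
  rw [hx.2] at hbudget
  -- STEP 5: strict binding `E(N) < E(n) + E(N − n)` and the thermodynamic bound at `n`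
  have hnltN : Fintype.card (BIdx P K) < N := Nat.lt_of_lt_of_le (Nat.lt_succ_self _) hNn
  obtain ⟨yn, hyn⟩ := LennardJonesGroundStatesExist_holds (Fintype.card (BIdx P K))
  obtain ⟨zn, hzn⟩ := LennardJonesGroundStatesExist_holds (N - Fintype.card (BIdx P K))
  have hbind := groundStateEnergy_add_lt (d := 3) (by norm_num) hnpos (Nat.sub_pos_of_lt hnltN)
    hyn hzn
  rw [Nat.add_sub_of_le hnltN.le] at hbind
  have hEn : groundStateEnergy lennardJones 3 (Fintype.card (BIdx P K)) <
      Fintype.card (BIdx P K) * (eStar + η / 8) := by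
    have h := hn₀ _ hn₀n
    rw [Real.dist_eq, abs_lt] at h
    have h2 := h.2
    rw [sub_lt_iff_lt_add, div_lt_iff₀ hnr] at h2
    linarith
  have hfin : (Fintype.card (BIdx P K) : ℝ) * (P.energyPerParticle lennardJones - 3 * η / 8) <
      Fintype.card (BIdx P K) * (eStar + η / 8) := by
    linarith
  have := lt_of_mul_lt_mul_left hfin hnr.le
  linarith

/-- **Stub `stub_selfCertify`** (line `Sketch` of crux `FineGrains`, stmt-AtomisticToContinuum-9330;
card `self-certifying-grains`): a periodic configuration `P` of `ℝ³` that appears, for every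
`(R, ε)` and frequently in `N`, as an origin-based isometric two-way `ε`-fine `R`-chart at a
particle of a Lennard-Jones ground state is a minimiser of the energy per particle over periodic
configurations (`energyPerParticle_le_eStar_of_charts` and `e* ≤ e(Q)`, `eStar_le`). [folklore] -/
theorem stub_selfCertify :
    ∀ P : PeriodicConfiguration 3,
    (∀ R ε : ℝ, 0 < R → 0 < ε → ∀ N₀ : ℕ, ∃ N : ℕ, N₀ ≤ N ∧ ∃ x : Fin N → E3,
      IsGroundState lennardJones x ∧ ∃ (i : Fin N) (A : E3 →ₗᵢ[ℝ] E3),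
        (∀ p ∈ P.points, ‖p‖ ≤ R → ∃ j : Fin N, dist (x j) (x i + A p) ≤ ε) ∧
        (∀ j : Fin N, dist (x j) (x i) ≤ R → ∃ p ∈ P.points, dist (x j) (x i + A p) ≤ ε)) →
    IsLeast (Set.range fun Q : PeriodicConfiguration 3 => Q.energyPerParticle lennardJones)
      (P.energyPerParticle lennardJones) := by
  intro P H
  refine ⟨⟨P, rfl⟩, ?_⟩
  rintro _ ⟨Q, rfl⟩
  exact (energyPerParticle_le_eStar_of_charts P H).trans (eStar_le Q)

end Summit.AtomisticToContinuum.Crystallization.Theorems.ExcessDecayLiouvilleFineGrains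

end
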